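import Literature.NumberTheory.Rogawski1990.AdelicStableOrbitalEulerDischargeG2
import Literature.NumberTheory.Automorphic.UnramifiedOrbitalEulerOfAdmissible
import Literature.NumberTheory.Automorphic.CompactCoreLevelPoint
import HarnessLib

/-!
# The rational-class geometric term READ on the self carrier: `J(𝒪_st(γ₀), f′) = Σ_{[γ] ⊂ 𝒪_st(γ₀)} Φ_{μ_𝐀}([toAdelic γ], f′)` — the kit's `J` side (rational
# classes, ★ C2 `ofLocal`) IS the left-hand side of the pre-stabilisation count (adelic classes, ★ C3 `ofLocalAdelic`) (Rogawski 1990, §5.4 p. 72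
# «`Φ(γ, f)` depends only on the image of `γ` in `𝒞_𝐀` under the natural map `𝒞 → 𝒞_𝐀`»; §14.5 p. 238)

Topic `NumberTheory/Rogawski1990`; namespace `Literature.NumberTheory.Rogawski1990`; **THEOREMS ONLY** (no definition, no named fact, no instance, no notation,
no `sorry`).  Cell `pub/hodgecm-mathlib`, ENGINE T1 (crux H413 = `stmt-HodgeConjecture-24833`), row O11, census steps S1 + S2 + S4(a) in ONE lemma: the bridge
from the engine line's `J 𝒪 f′ = 𝒪.orbitalSum Φ_{μA}(·, f′)` (pins (viii″)(viii‴): `μA = α(𝒪) • ofLocal mG mGi` on the regular classes) to the left-hand side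
`stableOrbitalSum σ H (fun c => Φ_{ofLocalAdelic mG mGi}(map toAdelic c, f′)) γ₀` of ★ `PreStabilisationCountSelf` (p813437), for CANONICAL local families
(pin (xi‴)) — every analytic side condition discharged (★ (K-J) `UnramifiedOrbitalEulerOfAdmissible` on the `ofLocal` side, ★ C3
`classOrbitalIntegral_ofLocalAdelic_eval_eq_mul_prod` + ★ p01 (G2-kernel C) `AdelicStableOrbitalEulerDischargeG2` on the `ofLocalAdelic` side: the two
terms are THE SAME honest Euler product `Φ_∞([γ_∞]) · ∏_{v ∈ S₂} Φ_v([γ_v])`).  HC_CM is proved only modulo the printed citations until rung 0 closes.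

* §1 per class: **`classOrbitalIntegral_ofLocalAdelic_map_toAdelic_eq_adelicClassOrbitalIntegral_ofLocal`** — for `γ₀` regular, `c ⊂ 𝒪_st(γ₀)` a rational class,
  `Φ_{ofLocalAdelic mG mGi}([toAdelic (out c)], T.eval) = Φ_{ofLocal mG mGi}(c, T.eval)`;
* §2 summed: **`stableOrbitalSum_ofLocalAdelic_map_toAdelic_eq_adelicStableOrbitalIntegral_ofLocal`** and, in the β-socket shape `μA c = ENNReal.ofReal r • ofLocal mG mGi c`
  on `𝒪_st(γ₀)`, **`adelicStableOrbitalIntegral_stableClassOf_eq_mul_stableOrbitalSum_ofLocalAdelic`**: `Φ^st_{μA}(𝒪_st(γ₀), T.eval) = r · Σ_{[γ] ⊂ 𝒪_st(γ₀)}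
  Φ_{ofLocalAdelic}([toAdelic γ], T.eval)` — what the O11 assembler rewrites with before ★ `MatchingAdeleG₂.stableOrbitalSum_map_toAdelic_eq_of_equiv`.

## References
* [Rogawski1990] J. D. Rogawski, *Automorphic Representations of Unitary Groups in Three Variables*, Ann. of Math. Stud. 123 (1990), §4.3 p. 44, §5.4 (5.4.1)–(5.4.3)
  pp. 72–73, §14.5 p. 238.
* [Kottwitz1986] R. E. Kottwitz, *Stable trace formula: elliptic singular terms*, Math. Ann. 275 (1986), Prop. 7.1, Cor. 7.3.
* [Gelbart1975] S. Gelbart, *Automorphic Forms on Adele Groups*, Ann. of Math. Stud. 83 (1975), p. 155 (10.19).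
-/

set_option autoImplicit false

noncomputable section

open MeasureTheory NumberField IsDedekindDomain Filter
open scoped Matrix MatrixGroups ENNReal

namespace Literature.NumberTheory.Rogawski1990

open Literature.NumberTheory.Automorphic
open Literature.AlgebraicGeometry.ShimuraVarieties (unitaryGroup hermForm)

section Bridge

variable {L : Type} [Field L] [NumberField L] [IsCMField L] {H : Matrix (Fin 3) (Fin 3) L} {γ₀ : (UnitaryGroup.cmDatum L 3 H).Rational}
  [∀ g : (UnitaryGroup.cmDatum L 3 H).Adelic,
    MeasurableSpace ((UnitaryGroup.cmDatum L 3 H).Adelic ⧸ Subgroup.centralizer ({g} : Set (UnitaryGroup.cmDatum L 3 H).Adelic))]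
  [∀ g : (UnitaryGroup.cmDatum L 3 H).Adelic,
    BorelSpace ((UnitaryGroup.cmDatum L 3 H).Adelic ⧸ Subgroup.centralizer ({g} : Set (UnitaryGroup.cmDatum L 3 H).Adelic))]
  [∀ (v : HeightOneSpectrum (𝓞 ↥(maximalRealSubfield L))) (x : (UnitaryGroup.cmDatum L 3 H).Local v),
    MeasurableSpace ((UnitaryGroup.cmDatum L 3 H).Local v ⧸ Subgroup.centralizer ({x} : Set ((UnitaryGroup.cmDatum L 3 H).Local v)))]
  [∀ (v : HeightOneSpectrum (𝓞 ↥(maximalRealSubfield L))) (x : (UnitaryGroup.cmDatum L 3 H).Local v),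
    BorelSpace ((UnitaryGroup.cmDatum L 3 H).Local v ⧸ Subgroup.centralizer ({x} : Set ((UnitaryGroup.cmDatum L 3 H).Local v)))]
  [∀ a : UnitaryGroup.arch (↥(maximalRealSubfield L)) L (IsCMField.complexConj L) 3 H,
    MeasurableSpace (UnitaryGroup.arch (↥(maximalRealSubfield L)) L (IsCMField.complexConj L) 3 H ⧸
      Subgroup.centralizer ({a} : Set (UnitaryGroup.arch (↥(maximalRealSubfield L)) L (IsCMField.complexConj L) 3 H)))]
  [∀ a : UnitaryGroup.arch (↥(maximalRealSubfield L)) L (IsCMField.complexConj L) 3 H,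
    BorelSpace (UnitaryGroup.arch (↥(maximalRealSubfield L)) L (IsCMField.complexConj L) 3 H ⧸
      Subgroup.centralizer ({a} : Set (UnitaryGroup.arch (↥(maximalRealSubfield L)) L (IsCMField.complexConj L) 3 H)))]
  [∀ v : HeightOneSpectrum (𝓞 ↥(maximalRealSubfield L)), MeasurableSpace ((UnitaryGroup.cmDatum L 3 H).Local v)]
  [∀ v : HeightOneSpectrum (𝓞 ↥(maximalRealSubfield L)), BorelSpace ((UnitaryGroup.cmDatum L 3 H).Local v)]

/-! ## §1 Per class: `Φ_{ofLocalAdelic}([toAdelic (out c)], T.eval) = Φ_{ofLocal}(c, T.eval)` for canonical local families -/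

omit [∀ g : (UnitaryGroup.cmDatum L 3 H).Adelic,
    MeasurableSpace ((UnitaryGroup.cmDatum L 3 H).Adelic ⧸ Subgroup.centralizer ({g} : Set (UnitaryGroup.cmDatum L 3 H).Adelic))]
  [∀ g : (UnitaryGroup.cmDatum L 3 H).Adelic,
    BorelSpace ((UnitaryGroup.cmDatum L 3 H).Adelic ⧸ Subgroup.centralizer ({g} : Set (UnitaryGroup.cmDatum L 3 H).Adelic))]
  [∀ a : UnitaryGroup.arch (↥(maximalRealSubfield L)) L (IsCMField.complexConj L) 3 H,
    MeasurableSpace (UnitaryGroup.arch (↥(maximalRealSubfield L)) L (IsCMField.complexConj L) 3 H ⧸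
      Subgroup.centralizer ({a} : Set (UnitaryGroup.arch (↥(maximalRealSubfield L)) L (IsCMField.complexConj L) 3 H)))]
  [∀ a : UnitaryGroup.arch (↥(maximalRealSubfield L)) L (IsCMField.complexConj L) 3 H,
    BorelSpace (UnitaryGroup.arch (↥(maximalRealSubfield L)) L (IsCMField.complexConj L) 3 H ⧸
      Subgroup.centralizer ({a} : Set (UnitaryGroup.arch (↥(maximalRealSubfield L)) L (IsCMField.complexConj L) 3 H)))] in
/-- **Every matching adèle of the SELF carrier over a regular `γ₀` is normalised off a finite set**, for CANONICAL local families (`(mG v).IsCanonical` on the regular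
classes for Haar `ν_v` with `ν_v(K_v) = 1`) — ★ `MatchingAdeleG₂.exists_isNormalisedOff` at `γ := γ₀` (the base point corresponds to itself), regularity of the local class
representatives from `γ₀`'s (★ `isRegularElt_toLocal_toAdelic`, ★ `isRegularElt_out_mk_local`). [cite: Rogawski1990, §4.3 pp. 43–44] [cite: Kottwitz1986, Prop. 7.1] -/
theorem MatchingAdeleG₂.exists_isNormalisedOff_self (hherm : (H.map (cmConjRingHom L))ᵀ = H) (hdet : H.det ≠ 0) (hreg : IsRegularElt (γ₀.val : GL (Fin 3) L))
    (ν : ∀ v : HeightOneSpectrum (𝓞 ↥(maximalRealSubfield L)), Measure ((UnitaryGroup.cmDatum L 3 H).Local v))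
    [∀ v, (ν v).IsHaarMeasure] [∀ v, (ν v).IsMulRightInvariant] (hν : ∀ v, ν v (UnitaryGroup.cmLocalIntegralLevel L 3 H v) = 1)
    (mG : ∀ v : HeightOneSpectrum (𝓞 ↥(maximalRealSubfield L)), OrbitalMeasureFamily ((UnitaryGroup.cmDatum L 3 H).Local v))
    (hcan : ∀ v, (mG v).IsCanonical (fun x => IsRegularElt (x.val : GL (Fin 3) (UnitaryGroup.LocalRing L v))) (ν v)) (p : MatchingAdeleG₂ L H H γ₀) :
    ∃ S₀ : Finset (HeightOneSpectrum (𝓞 ↥(maximalRealSubfield L))), UnitaryGroup.IsNormalisedOff L 3 H mG p.adele S₀ :=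
  MatchingAdeleG₂.exists_isNormalisedOff hherm hdet hreg (γ := γ₀) (IsConj.refl _) _ ν hν mG hcan p fun v =>
    isRegularElt_out_mk_local (isRegularElt_of_isConj (p.corresponds_toLocal v) (isRegularElt_toLocal_toAdelic L H γ₀ hreg v))

/-- **PER CLASS — the two currencies give the same orbital integral**: `H` anisotropic hermitian, CANONICAL local families `mG v` (for Haar `ν_v`, `ν_v(K_v) = 1`), `mGi`
admissible on the regular archimedean classes, `γ₀` regular, `c ⊂ 𝒪_st(γ₀)` a rational class, `T` an `IsTest` pure tensor:
`classOrbitalIntegral (ofLocalAdelic mG mGi) T.eval (ConjClasses.map toAdelic c) = adelicClassOrbitalIntegral (ofLocal mG mGi) T.eval c` — both are the honest product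
`Φ_{mGi}([γ_∞], T.arch) · ∏_{v∈S₂} Φ_{mG v}([γ_v], T.loc v)`, `γ = toAdelic (out c)` (★ (K-J) `exists_finset_forall_loc_eq_one_and_ofLocal_eval_eq_mul_prod_of_isAdmissibleOn` on the right;
★ C3 `classOrbitalIntegral_ofLocalAdelic_eval_eq_mul_prod` at `[γ]` — whose representative has the same local classes, ★ `conjClassesMk_toLocal_out_eq` — on the left, its
normalisation ∕ integrability hypotheses discharged by `exists_isNormalisedOff_self` ∕ ★ `MatchingAdeleG₂.integrable_descConj_ofLocalAdelic_of_mem_classes`).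
[cite: Rogawski1990, §5.4 p. 72] [cite: Gelbart1975, p. 155 (10.19)] [cite: Kottwitz1986, Cor. 7.3] -/
theorem classOrbitalIntegral_ofLocalAdelic_map_toAdelic_eq_adelicClassOrbitalIntegral_ofLocal
    (hanis : ∀ x : Fin 3 → L, hermForm (cmConjRingHom L) H x x = 0 → x = 0) (hherm : (H.map (cmConjRingHom L))ᵀ = H)
    (ν : ∀ v : HeightOneSpectrum (𝓞 ↥(maximalRealSubfield L)), Measure ((UnitaryGroup.cmDatum L 3 H).Local v))
    [∀ v, (ν v).IsHaarMeasure] [∀ v, (ν v).IsMulRightInvariant] (hν : ∀ v, ν v (UnitaryGroup.cmLocalIntegralLevel L 3 H v) = 1)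
    (mG : ∀ v : HeightOneSpectrum (𝓞 ↥(maximalRealSubfield L)), OrbitalMeasureFamily ((UnitaryGroup.cmDatum L 3 H).Local v))
    (hcan : ∀ v, (mG v).IsCanonical (fun x => IsRegularElt (x.val : GL (Fin 3) (UnitaryGroup.LocalRing L v))) (ν v))
    (mGi : OrbitalMeasureFamily (UnitaryGroup.arch (↥(maximalRealSubfield L)) L (IsCMField.complexConj L) 3 H))
    (hadmA : mGi.IsAdmissibleOn fun a => IsRegularElt (a.val : GL (Fin 3) (mixedEmbedding.mixedSpace L)))
    (hreg : IsRegularElt (γ₀.val : GL (Fin 3) L)) {c : ConjClasses (UnitaryGroup.cmDatum L 3 H).Rational} (hc : c ∈ conjClassesIn (cmConjRingHom L) H γ₀)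
    (T : UnitaryGroup.PureTensor L 3 H) (hT : T.IsTest) :
    classOrbitalIntegral (UnitaryGroup.OrbitalMeasureFamily.ofLocalAdelic L 3 H mG mGi) T.eval (ConjClasses.map (UnitaryGroup.cmDatum L 3 H).toAdelic c) =
      UnitaryGroup.adelicClassOrbitalIntegral L 3 H (UnitaryGroup.AdelicOrbitalMeasureFamily.ofLocal L 3 H mG mGi) T.eval c := by
  classical
  have hdet : H.det ≠ 0 := Godement.det_ne_zero_of_anisotropic L H hanis
  have hadm : ∀ v, (mG v).IsAdmissibleOn fun x => IsRegularElt (x.val : GL (Fin 3) (UnitaryGroup.LocalRing L v)) := fun v => (hcan v).isAdmissibleOn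
  have hcreg : IsRegularElt ((Quotient.out c).val : GL (Fin 3) L) := UnitaryGroup.isRegularElt_out_of_mem_conjClassesIn L 3 H hreg hc
  -- (1) normalisation at the diagonal point `toAdelic (out c)` (canonicity + compact cores inside `K_v` a.e.)
  have hnormc : ∃ S₀ : Finset (HeightOneSpectrum (𝓞 ↥(maximalRealSubfield L))),
      UnitaryGroup.IsNormalisedOff L 3 H mG ((UnitaryGroup.cmDatum L 3 H).toAdelic (Quotient.out c)) S₀ :=
    UnitaryGroup.exists_isNormalisedOff_of_isCanonical L 3 H _ ν hν mG hcan (UnitaryGroup.compactCoreCentralizerLevelAE_of_hermitian L 3 H hherm hdet)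
      (Quotient.out c) hcreg fun v => isRegularElt_out_mk_toLocal_toAdelic L H (Quotient.out c) hcreg v
  -- (2) the J-side Euler product with its unit clause
  obtain ⟨S₂, -, hf1, hJ⟩ := UnitaryGroup.exists_finset_forall_loc_eq_one_and_ofLocal_eval_eq_mul_prod_of_isAdmissibleOn L 3 H mG mGi c hanis hherm hadm
    hadmA hcreg hnormc T hT
  -- (3) the adelic class of `toAdelic (out c)` is a class of the self carrier
  rw [conjClasses_map_toAdelic_eq_mk_out]
  have hδmem : ConjClasses.mk ((UnitaryGroup.cmDatum L 3 H).toAdelic (Quotient.out c)) ∈ MatchingAdeleG₂.classes L H H γ₀ := by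
    rw [← conjClasses_map_toAdelic_eq_mk_out]
    exact MatchingAdeleG₂.map_toAdelic_mem_classes γ₀ hc
  -- (4) its representative is a matching adèle: normalised, regular components, integrable orbital integrand
  have hnormall : ∀ p : MatchingAdeleG₂ L H H γ₀, ∃ S₀ : Finset (HeightOneSpectrum (𝓞 ↥(maximalRealSubfield L))),
      UnitaryGroup.IsNormalisedOff L 3 H mG p.adele S₀ := MatchingAdeleG₂.exists_isNormalisedOff_self hherm hdet hreg ν hν mG hcan
  obtain ⟨q, hq⟩ := MatchingAdeleG₂.exists_adele_eq_out_of_mem_classes hδmem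
  obtain ⟨S₀', hS₀'⟩ := hnormall q
  rw [hq] at hS₀'
  have hqv : ∀ v, IsRegularElt (((UnitaryGroup.cmDatum L 3 H).toLocal v
      (Quotient.out (ConjClasses.mk ((UnitaryGroup.cmDatum L 3 H).toAdelic (Quotient.out c))) : (UnitaryGroup.cmDatum L 3 H).Adelic)).val :
        GL (Fin 3) (UnitaryGroup.LocalRing L v)) := fun v => by
    rw [← hq]
    exact isRegularElt_of_isConj (q.corresponds_toLocal v) (isRegularElt_toLocal_toAdelic L H γ₀ hreg v)
  have hqa : IsRegularElt ((UnitaryGroup.archPart (↥(maximalRealSubfield L)) L (IsCMField.complexConj L) 3 H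
      (Quotient.out (ConjClasses.mk ((UnitaryGroup.cmDatum L 3 H).toAdelic (Quotient.out c))) : (UnitaryGroup.cmDatum L 3 H).Adelic)).val :
        GL (Fin 3) (mixedEmbedding.mixedSpace L)) := by
    have h := q.corresponds_arch
    rw [MatchingAdeleG₂.arch, hq] at h
    exact isRegularElt_of_isConj h (isRegularElt_cmRationalToArch L H γ₀ hreg)
  have hadm' := fun v => (hadm v).at_mk_of_isConj (fun a b hab ha => (isRegularElt_iff_of_isConj_local L H v hab).1 ha) _ (hqv v)
  have hadmA' := hadmA.at_mk_of_isConj (fun a b hab ha => (isRegularElt_iff_of_isConj_arch hab).1 ha) _ hqa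
  have hFi' := MatchingAdeleG₂.integrable_descConj_ofLocalAdelic_of_mem_classes hherm hdet hreg mG mGi hadm hadmA hnormall T hT _ hδmem
  -- (5) the unit clause at the representative's local classes (= those of `toAdelic (out c)`)
  have hf1' : ∀ v, v ∉ S₂ → classOrbitalIntegral (mG v) (T.loc v) (ConjClasses.mk ((UnitaryGroup.cmDatum L 3 H).toLocal v
      (Quotient.out (ConjClasses.mk ((UnitaryGroup.cmDatum L 3 H).toAdelic (Quotient.out c))) : (UnitaryGroup.cmDatum L 3 H).Adelic))) = 1 := by
    intro v hv
    rw [UnitaryGroup.conjClassesMk_toLocal_out_eq L 3 H]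
    exact hf1 v hv
  -- (6) the adelic-side Euler product and the comparison
  rw [UnitaryGroup.classOrbitalIntegral_ofLocalAdelic_eval_eq_mul_prod L 3 H mG mGi _ hS₀' hadm' hadmA' T S₂ hT.isUnramified hFi' hf1', hJ,
    UnitaryGroup.conjClassesMk_archPart_out_eq L 3 H]
  exact congrArg _ (Finset.prod_congr rfl fun v _ => by rw [UnitaryGroup.conjClassesMk_toLocal_out_eq L 3 H])

/-! ## §2 Summed over the stable class: the kit's `J`-term IS the left-hand side of the pre-stabilisation count -/

/-- **`Φ^st_{ofLocal}(𝒪_st(γ₀), T.eval) = Σ_{[γ] ⊂ 𝒪_st(γ₀)} Φ_{ofLocalAdelic}([toAdelic γ], T.eval)`** — the rational-class stable sum of ★ C2's family IS ★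
`PreStabilisationCountSelf`'s left-hand side (§1 class by class, `finsum_mem_congr`). [cite: Rogawski1990, §5.4 (5.4.1) p. 72; §14.5 p. 238] -/
theorem stableOrbitalSum_ofLocalAdelic_map_toAdelic_eq_adelicStableOrbitalIntegral_ofLocal
    (hanis : ∀ x : Fin 3 → L, hermForm (cmConjRingHom L) H x x = 0 → x = 0) (hherm : (H.map (cmConjRingHom L))ᵀ = H)
    (ν : ∀ v : HeightOneSpectrum (𝓞 ↥(maximalRealSubfield L)), Measure ((UnitaryGroup.cmDatum L 3 H).Local v))
    [∀ v, (ν v).IsHaarMeasure] [∀ v, (ν v).IsMulRightInvariant] (hν : ∀ v, ν v (UnitaryGroup.cmLocalIntegralLevel L 3 H v) = 1)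
    (mG : ∀ v : HeightOneSpectrum (𝓞 ↥(maximalRealSubfield L)), OrbitalMeasureFamily ((UnitaryGroup.cmDatum L 3 H).Local v))
    (hcan : ∀ v, (mG v).IsCanonical (fun x => IsRegularElt (x.val : GL (Fin 3) (UnitaryGroup.LocalRing L v))) (ν v))
    (mGi : OrbitalMeasureFamily (UnitaryGroup.arch (↥(maximalRealSubfield L)) L (IsCMField.complexConj L) 3 H))
    (hadmA : mGi.IsAdmissibleOn fun a => IsRegularElt (a.val : GL (Fin 3) (mixedEmbedding.mixedSpace L)))
    (hreg : IsRegularElt (γ₀.val : GL (Fin 3) L)) (T : UnitaryGroup.PureTensor L 3 H) (hT : T.IsTest) :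
    stableOrbitalSum (cmConjRingHom L) H (fun c => classOrbitalIntegral (UnitaryGroup.OrbitalMeasureFamily.ofLocalAdelic L 3 H mG mGi) T.eval
        (ConjClasses.map (UnitaryGroup.cmDatum L 3 H).toAdelic c)) γ₀ =
      UnitaryGroup.adelicStableOrbitalIntegral L 3 H (UnitaryGroup.AdelicOrbitalMeasureFamily.ofLocal L 3 H mG mGi) T.eval (stableClassOf (cmConjRingHom L) H γ₀) := by
  rw [UnitaryGroup.adelicStableOrbitalIntegral_stableClassOf, stableOrbitalSum, stableOrbitalSum]
  exact finsum_mem_congr rfl fun c hc =>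
    classOrbitalIntegral_ofLocalAdelic_map_toAdelic_eq_adelicClassOrbitalIntegral_ofLocal hanis hherm ν hν mG hcan mGi hadmA hreg hc T hT

/-- **THE KIT'S `J`-TERM IN THE PRE-STABILISATION'S CURRENCY (β-socket shape)**: if `μA c = ENNReal.ofReal r • ofLocal mG mGi c` on the rational classes of the regular stable
class `𝒪_st(γ₀)` (`0 ≤ r` — the line's pins (viii″)(viii‴) with `r = α(𝒪_st)`), then
`Φ^st_{μA}(𝒪_st(γ₀), T.eval) = r · Σ_{[γ] ⊂ 𝒪_st(γ₀)} Φ_{ofLocalAdelic mG mGi}([toAdelic γ], T.eval)` — `J(𝒪_st, f′)` equals `α(𝒪_st)` times the left-hand side of ★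
`MatchingAdeleG₂.stableOrbitalSum_map_toAdelic_eq_of_equiv` (★ (K-J) `adelicStableOrbitalIntegral_stableClassOf_eq_toReal_mul_of_forall_eq_smul` + §2).
[cite: Rogawski1990, §14.5 p. 238; §5.4 (5.4.1)–(5.4.3) pp. 72–73] -/
theorem adelicStableOrbitalIntegral_stableClassOf_eq_mul_stableOrbitalSum_ofLocalAdelic
    (hanis : ∀ x : Fin 3 → L, hermForm (cmConjRingHom L) H x x = 0 → x = 0) (hherm : (H.map (cmConjRingHom L))ᵀ = H)
    (ν : ∀ v : HeightOneSpectrum (𝓞 ↥(maximalRealSubfield L)), Measure ((UnitaryGroup.cmDatum L 3 H).Local v))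
    [∀ v, (ν v).IsHaarMeasure] [∀ v, (ν v).IsMulRightInvariant] (hν : ∀ v, ν v (UnitaryGroup.cmLocalIntegralLevel L 3 H v) = 1)
    (mG : ∀ v : HeightOneSpectrum (𝓞 ↥(maximalRealSubfield L)), OrbitalMeasureFamily ((UnitaryGroup.cmDatum L 3 H).Local v))
    (hcan : ∀ v, (mG v).IsCanonical (fun x => IsRegularElt (x.val : GL (Fin 3) (UnitaryGroup.LocalRing L v))) (ν v))
    (mGi : OrbitalMeasureFamily (UnitaryGroup.arch (↥(maximalRealSubfield L)) L (IsCMField.complexConj L) 3 H))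
    (hadmA : mGi.IsAdmissibleOn fun a => IsRegularElt (a.val : GL (Fin 3) (mixedEmbedding.mixedSpace L)))
    (hreg : IsRegularElt (γ₀.val : GL (Fin 3) L))
    (μA : UnitaryGroup.AdelicOrbitalMeasureFamily L 3 H) {r : ℝ} (hr : 0 ≤ r)
    (hμA : ∀ c ∈ conjClassesIn (cmConjRingHom L) H γ₀, μA c = ENNReal.ofReal r • UnitaryGroup.AdelicOrbitalMeasureFamily.ofLocal L 3 H mG mGi c)
    (T : UnitaryGroup.PureTensor L 3 H) (hT : T.IsTest) :
    UnitaryGroup.adelicStableOrbitalIntegral L 3 H μA T.eval (stableClassOf (cmConjRingHom L) H γ₀) =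
      (r : ℂ) * stableOrbitalSum (cmConjRingHom L) H (fun c => classOrbitalIntegral (UnitaryGroup.OrbitalMeasureFamily.ofLocalAdelic L 3 H mG mGi) T.eval
        (ConjClasses.map (UnitaryGroup.cmDatum L 3 H).toAdelic c)) γ₀ := by
  rw [UnitaryGroup.adelicStableOrbitalIntegral_stableClassOf_eq_toReal_mul_of_forall_eq_smul L 3 H μA
      (UnitaryGroup.AdelicOrbitalMeasureFamily.ofLocal L 3 H mG mGi) (ENNReal.ofReal r) hμA, ENNReal.toReal_ofReal hr,
    stableOrbitalSum_ofLocalAdelic_map_toAdelic_eq_adelicStableOrbitalIntegral_ofLocal hanis hherm ν hν mG hcan mGi hadmA hreg T hT]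

end Bridge

end Literature.NumberTheory.Rogawski1990
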